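import Summits.BirchSwinnertonDyer.BirchSwinnertonDyer.Theorems.EdixhovenFibreFiveSevenStarredOptimalManinUnitFiveSevenReciprocityTowerFromAbove
import Summits.BirchSwinnertonDyer.BirchSwinnertonDyer.Theorems.EdixhovenFibreFiveSevenStarredOptimalManinUnitFiveSevenSemiLocalIntegralityPinAt
import Literature.NumberTheory.PAdicHodge.PointGroupPadicIntFunctional
import Literature.NumberTheory.AdelicBaseChange.CyclotomicCompletionProofs
import HarnessLib

/-!
# [REC-tower] AT THE CYCLOTOMIC TOWER `ℚ_v ⊆ ℚ(ζ_m)_w` from Kato's formula over a finite `K′ ⊇ ℚ(ζ_m)_w` — the from-above theorem read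
# in the packet keys (route `EdixhovenFibreFiveSeven`, crux K★ stmt-BirchSwinnertonDyer-22226, line `kato-lever`; seat `bsd-line-edix-p1` g29, LEAD)

HONEST FRAMING. TOOL theorem only (no definition, no named fact, no `sorry`; file-local instance keys on `ℚ_v` byte-identical to
`…SemiLocalIntegralityPinAt` l.164–169); nothing is closed; BSD / K★ / the REC stubs are NOT proved by this. It is
`StarredOptimalManinUnitFiveSevenReciprocityTowerFromAbove.exists_const_tower_clauses_of_formula_above` (p758499) SPECIALISED to `K₀ = ℚ`,
`F₀ = ℚ_v = Place.Completion (inr v_p)` (packet keys), `F = L_w = ℚ(ζ_m)_w` (`letI` keys of the stubs of skeleton v8: `adicCompletionPadicAlgebra`,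
`instEF`), with the tower's instance inputs DISCHARGED: `IsGalois ℚ_v L_w` (`CyclotomicCompletionProofs.isGalois_adicCompletion_cyclotomicField`),
`FiniteDimensional` (`IsCyclotomicExtension.finiteDimensional`, `finiteDimensional_padicAlgebra`), `IsScalarTower ℚ_[p] ℚ_v L_w`
(`KimAtThreeDeepLowerExpStarOmegaRes.isScalarTower_padicAlgebra_of_continuous`), `IsScalarTower ℚ ℚ_v L_w` (`IsScalarTower.rat`), and `hφ`
(`PointGroupPadicIntFunctional.exists_addMonoidHom_baseChange_point_padicInt_ne_zero'`). What remains displayed = exactly the stub's own binders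
(Weil tower, `d₀`, `d`, Prop-1.2.3 at `L_w`, `hcomp`) + the `K′`-package (a finite `K′ ⊇ L_w` with keys, `w′`, Prop-1.2.3 at `K′`, `d′`, `hcomp′`, `hlog`,
`hlog′`, the intertwiners) + Kato's formula over `K′` for the DIRECT representation with ANY constant (= T5-A p776357 ∘ T5-B/C). So
`stub_recTowerSupersingularCells` ⟸ this theorem ∘ (RES) ∘ de Rham ascent ∘ T5 (memo `Lines/kato-lever-seam-rec-at-cells.md` §5).

* ★★ `recTowerAt_cyclotomic_of_formula_above`.

References: [Kato1993LNM1553] Ch. II §1.2.4, Thm. 1.4.1 (4); [SerreLocalFields1979] XIII §3 Prop. 7; [NeukirchANT1999] Ch. II (7.12), §8.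
-/

set_option autoImplicit false
-- the Theorems namespace of a single-conjunct summit repeats the summit name by design (D-0017)
set_option linter.dupNamespace false

noncomputable section

open scoped Classical NNReal TensorProduct NumberField
open CategoryTheory Function Field ValuativeRel IsDedekindDomain NumberField
open Literature.NumberTheory.GaloisRepresentations
open Literature.NumberTheory.GaloisRepresentations.IsNonarchimedeanLocalField
open Literature.NumberTheory.GaloisRepresentations.PeriodRingData
open Literature.NumberTheory.PAdicHodge
open Literature.NumberTheory.EllipticCurves _root_.WeierstrassCurve
open Literature.NumberTheory.EllipticCurves.FormalGroupChart (padicLogPointFiniteExt)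
open Summit.BirchSwinnertonDyer.BirchSwinnertonDyer.Theorems.StarredOptimalManinUnitFiveSevenReciprocityGaloisDescent
open Summit.BirchSwinnertonDyer.BirchSwinnertonDyer.Theorems.StarredOptimalManinUnitFiveSevenReciprocityTowerFromAbove
open Summit.BirchSwinnertonDyer.BirchSwinnertonDyer.Theorems.KimAtThreeDeepLowerExpStarOmega
open Summit.BirchSwinnertonDyer.BirchSwinnertonDyer.Theorems.KimAtThreeDeepLowerExpStarOmegaPlace
open Summit.BirchSwinnertonDyer.BirchSwinnertonDyer.Theorems.KimAtThreeDeepLowerExpStarOmegaRes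
open Summit.BirchSwinnertonDyer.BirchSwinnertonDyer.Theorems.KimAtThreeDeepUpperTowerLattice (fact_natCast_mem_primesEquiv_symm)
open Summit.BirchSwinnertonDyer.BirchSwinnertonDyer.Theorems.KPort
open Summit.BirchSwinnertonDyer.Rank1Residual.GaloisImage
open Rat.HeightOneSpectrum
open Literature.NumberTheory.AdelicBaseChange

namespace Summit.BirchSwinnertonDyer.BirchSwinnertonDyer.Theorems.StarredOptimalManinUnitFiveSevenRecTowerAtCyclotomicFromAbove

variable (W : WeierstrassCurve ℚ) [W.IsElliptic] (p : ℕ) [hp : Fact p.Prime]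

-- FILE-LOCAL instance keys, byte-identical to the accepted `…SemiLocalIntegralityPinAt.lean` l.164–169 (no library instance is
-- overridden outside this file): the `Fact (p ∈ v_p)` key and the local-field structures on `ℚ_v = Place.Completion (inr v_p)`.
attribute [local instance] fact_natCast_mem_primesEquiv_symm
attribute [local instance 100000] NumberField.Place.instAlgebraCompletion
attribute [local instance] valuativeRelPlace topologicalSpacePlace
attribute [local instance] isNonarchimedeanLocalField_place charZero_place
attribute [local instance] padicAlgebraPlace fact_not_isUnit_place isAdicComplete_place

set_option backward.isDefEq.respectTransparency false in
set_option maxHeartbeats 1600000 in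
/-- ★★ **[REC-tower] at the cyclotomic tower `ℚ_v ⊆ ℚ(ζ_m)_w` from Kato's formula over a finite `K′ ⊇ ℚ(ζ_m)_w` with ANY constant** —
`exists_const_tower_clauses_of_formula_above` in the packet keys, with `IsGalois`, `FiniteDimensional`, the two `IsScalarTower`s and `hφ` discharged.
The conclusion is the [REC-tower] body clause `∃ c₀ ≠ 0, lower ∧ upper` of the stubs of skeleton v8 at `(W, ℚ_v ⊆ L_w, wv, ν, e, d₀, d)`.
[cite: Kato1993LNM1553, Ch. II §1.2.4 and Thm. 1.4.1 (4)] [cite: SerreLocalFields1979, XIII §3 Prop. 7] [cite: NeukirchANT1999, Ch. II (7.12)] -/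
theorem recTowerAt_cyclotomic_of_formula_above (m : ℕ) [NeZero m]
    (w : ((primesEquiv (R := 𝓞 ℚ)).symm ⟨p, hp.out⟩).Extension (𝓞 (CyclotomicField m ℚ)))
    (hw : ((p : ℕ) : 𝓞 (CyclotomicField m ℚ)) ∈ w.1.asIdeal)
    [CharZero (w.1.adicCompletion (CyclotomicField m ℚ))]
    [Fact (¬ IsUnit ((p : ℕ) : integerC (w.1.adicCompletion (CyclotomicField m ℚ))))]
    [IsAdicComplete (Ideal.span {((p : ℕ) : integerC (w.1.adicCompletion (CyclotomicField m ℚ)))}) (integerC (w.1.adicCompletion (CyclotomicField m ℚ)))]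
    (hL : valuation (w.1.adicCompletion (CyclotomicField m ℚ)) ((p : ℕ) : (w.1.adicCompletion (CyclotomicField m ℚ))) < 1) :
    letI := LocalField.adicCompletionPadicAlgebra w.1 p hw
    letI : Algebra (Place.Completion (K := ℚ) (Sum.inr ((primesEquiv (R := 𝓞 ℚ)).symm ⟨p, hp.out⟩))) (w.1.adicCompletion (CyclotomicField m ℚ)) :=
      inferInstanceAs (Algebra (((primesEquiv (R := 𝓞 ℚ)).symm ⟨p, hp.out⟩).adicCompletion ℚ) (w.1.adicCompletion (CyclotomicField m ℚ)))
    ∀ (wv : Valuation (Place.Completion (Sum.inr ((primesEquiv (R := 𝓞 ℚ)).symm ⟨p, hp.out⟩) : Place ℚ)) ℝ≥0) [wv.Compatible] [(W.baseChange (Place.Completion (Sum.inr ((primesEquiv (R := 𝓞 ℚ)).symm ⟨p, hp.out⟩) : Place ℚ))).IsIntegral wv.integer]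
      (ν : Valuation (w.1.adicCompletion (CyclotomicField m ℚ)) ℝ≥0) [ν.Compatible] [(W.baseChange (w.1.adicCompletion (CyclotomicField m ℚ))).IsIntegral ν.integer]
      -- the upper field `K′ ⊇ L_w`
      {K' : Type} [Field K'] [Algebra ℚ K'] [Algebra (w.1.adicCompletion (CyclotomicField m ℚ)) K'] [IsScalarTower ℚ (w.1.adicCompletion (CyclotomicField m ℚ)) K'] [ValuativeRel K'] [TopologicalSpace K']
      [IsNonarchimedeanLocalField K'] [CharZero K'] [Fact (¬ IsUnit (p : integerC K'))]
      [IsAdicComplete (Ideal.span {(p : integerC K')}) (integerC K')]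
      (hp' : valuation K' p < 1) [Algebra ℚ_[p] K'] [IsScalarTower ℚ_[p] (w.1.adicCompletion (CyclotomicField m ℚ)) K'] [FiniteDimensional (w.1.adicCompletion (CyclotomicField m ℚ)) K']
      (w' : Valuation K' ℝ≥0) [(W.baseChange K').IsIntegral w'.integer]
    -- the Weil tower
    (e : (k : ℕ) → geomTorsion W ((p ^ k : ℕ) : ℤ) → geomTorsion W ((p ^ k : ℕ) : ℤ) → AlgebraicClosure ℚ)
    (hμ : ∀ k S T, e k S T ^ (p ^ k) = 1) (hadd₁ : ∀ k S₁ S₂ T, e k (S₁ + S₂) T = e k S₁ T * e k S₂ T)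
    (hadd₂ : ∀ k S T₁ T₂, e k S (T₁ + T₂) = e k S T₁ * e k S T₂)
    (hgal : ∀ k (σ : absoluteGaloisGroup ℚ) (S T : geomTorsion W ((p ^ k : ℕ) : ℤ)), σ • e k S T = e k (σ • S) (σ • T))
    (hcompat : ∀ k (S T : geomTorsion W ((p ^ (k + 1) : ℕ) : ℤ)),
      e k (torsionMulHom W (p ^ (k + 1)) (p ^ k) p (pow_succ p k).symm S)
        (torsionMulHom W (p ^ (k + 1)) (p ^ k) p (pow_succ p k).symm T) = e (k + 1) S T ^ p)
    -- the intertwiners `V(γ⁻¹)` of the two towers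
    {gV : W.rationalTateModule p ≃ₗ[ℚ_[p]] W.rationalTateModule p}
    (hgVdef : ∀ x, gV x = (W.rationalTateGaloisRep p (W.continuous_rationalGaloisRepTate_holds p)) (towerConjElement ℚ (Place.Completion (Sum.inr ((primesEquiv (R := 𝓞 ℚ)).symm ⟨p, hp.out⟩) : Place ℚ)) (w.1.adicCompletion (CyclotomicField m ℚ)))⁻¹ x)
    {gV' : W.rationalTateModule p ≃ₗ[ℚ_[p]] W.rationalTateModule p}
    (hgV'def : ∀ x, gV' x = (W.rationalTateGaloisRep p (W.continuous_rationalGaloisRepTate_holds p)) (towerConjElement ℚ (w.1.adicCompletion (CyclotomicField m ℚ)) K')⁻¹ x)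
    (hnondeg : ∀ k (T : geomTorsion W ((p ^ k : ℕ) : ℤ)), (∀ S, e k S T = 1) → T = 0)
    -- binders of the tower representation over `F` (relative to `F₀`)
    (hinj : (bdRPeriodRingData (F := (w.1.adicCompletion (CyclotomicField m ℚ))) (p := p) hL).CupLogInjective (logCyclotomic p)
      ((restrictedRationalTateRep W (Place.Completion (Sum.inr ((primesEquiv (R := 𝓞 ℚ)).symm ⟨p, hp.out⟩) : Place ℚ)) p).restrict (absGaloisRestrict (Place.Completion (Sum.inr ((primesEquiv (R := 𝓞 ℚ)).symm ⟨p, hp.out⟩) : Place ℚ)) (w.1.adicCompletion (CyclotomicField m ℚ)))))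
    (hde : ∀ z : contOneCocycles ((restrictedRationalTateRep W (Place.Completion (Sum.inr ((primesEquiv (R := 𝓞 ℚ)).symm ⟨p, hp.out⟩) : Place ℚ)) p).restrict (absGaloisRestrict (Place.Completion (Sum.inr ((primesEquiv (R := 𝓞 ℚ)).symm ⟨p, hp.out⟩) : Place ℚ)) (w.1.adicCompletion (CyclotomicField m ℚ)))).toTopRep,
      (bdRPeriodRingData (F := (w.1.adicCompletion (CyclotomicField m ℚ))) (p := p) hL).HasDualExp (logCyclotomic p)
        ((restrictedRationalTateRep W (Place.Completion (Sum.inr ((primesEquiv (R := 𝓞 ℚ)).symm ⟨p, hp.out⟩) : Place ℚ)) p).restrict (absGaloisRestrict (Place.Completion (Sum.inr ((primesEquiv (R := 𝓞 ℚ)).symm ⟨p, hp.out⟩) : Place ℚ)) (w.1.adicCompletion (CyclotomicField m ℚ)))) fun σ => z.1 σ)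
    -- binders of the tower representation over `K'` (relative to `F`)
    (hinj' : (bdRPeriodRingData (F := K') (p := p) hp').CupLogInjective (logCyclotomic p)
      ((restrictedRationalTateRep W (w.1.adicCompletion (CyclotomicField m ℚ)) p).restrict (absGaloisRestrict (w.1.adicCompletion (CyclotomicField m ℚ)) K')))
    (hde' : ∀ z : contOneCocycles ((restrictedRationalTateRep W (w.1.adicCompletion (CyclotomicField m ℚ)) p).restrict (absGaloisRestrict (w.1.adicCompletion (CyclotomicField m ℚ)) K')).toTopRep,
      (bdRPeriodRingData (F := K') (p := p) hp').HasDualExp (logCyclotomic p)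
        ((restrictedRationalTateRep W (w.1.adicCompletion (CyclotomicField m ℚ)) p).restrict (absGaloisRestrict (w.1.adicCompletion (CyclotomicField m ℚ)) K')) fun σ => z.1 σ)
    -- line data and compatibilities
    (d₀ : (bdRPeriodRingData (F := (Place.Completion (Sum.inr ((primesEquiv (R := 𝓞 ℚ)).symm ⟨p, hp.out⟩) : Place ℚ))) (p := p) (valuation_place_lt_one p ((primesEquiv (R := 𝓞 ℚ)).symm ⟨p, hp.out⟩))).FilZeroLine (restrictedRationalTateRep W (Place.Completion (Sum.inr ((primesEquiv (R := 𝓞 ℚ)).symm ⟨p, hp.out⟩) : Place ℚ)) p))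
    (d : (bdRPeriodRingData (F := (w.1.adicCompletion (CyclotomicField m ℚ))) (p := p) hL).FilZeroLine ((restrictedRationalTateRep W (Place.Completion (Sum.inr ((primesEquiv (R := 𝓞 ℚ)).symm ⟨p, hp.out⟩) : Place ℚ)) p).restrict (absGaloisRestrict (Place.Completion (Sum.inr ((primesEquiv (R := 𝓞 ℚ)).symm ⟨p, hp.out⟩) : Place ℚ)) (w.1.adicCompletion (CyclotomicField m ℚ)))))
    (d' : (bdRPeriodRingData (F := K') (p := p) hp').FilZeroLine ((restrictedRationalTateRep W (w.1.adicCompletion (CyclotomicField m ℚ)) p).restrict (absGaloisRestrict (w.1.adicCompletion (CyclotomicField m ℚ)) K')))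
    (hcomp : ∀ (η₀ : contOneCocycles (restrictedTateRep W (Place.Completion (Sum.inr ((primesEquiv (R := 𝓞 ℚ)).symm ⟨p, hp.out⟩) : Place ℚ)) p).toTopRep)
        (η : contOneCocycles ((restrictedTateRep W (Place.Completion (Sum.inr ((primesEquiv (R := 𝓞 ℚ)).symm ⟨p, hp.out⟩) : Place ℚ)) p).restrict (absGaloisRestrict (Place.Completion (Sum.inr ((primesEquiv (R := 𝓞 ℚ)).symm ⟨p, hp.out⟩) : Place ℚ)) (w.1.adicCompletion (CyclotomicField m ℚ)))).toTopRep),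
        (∀ σ, η.1 σ = η₀.1 (absGaloisRestrict (Place.Completion (Sum.inr ((primesEquiv (R := 𝓞 ℚ)).symm ⟨p, hp.out⟩) : Place ℚ)) (w.1.adicCompletion (CyclotomicField m ℚ)) σ)) →
        expStarCoordTower W hL d η = algebraMap (Place.Completion (Sum.inr ((primesEquiv (R := 𝓞 ℚ)).symm ⟨p, hp.out⟩) : Place ℚ)) (w.1.adicCompletion (CyclotomicField m ℚ)) (expStarCoord W (valuation_place_lt_one p ((primesEquiv (R := 𝓞 ℚ)).symm ⟨p, hp.out⟩)) d₀ η₀))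
    (hcomp' : ∀ (η : contOneCocycles (restrictedTateRep W (w.1.adicCompletion (CyclotomicField m ℚ)) p).toTopRep)
        (η' : contOneCocycles ((restrictedTateRep W (w.1.adicCompletion (CyclotomicField m ℚ)) p).restrict (absGaloisRestrict (w.1.adicCompletion (CyclotomicField m ℚ)) K')).toTopRep),
        (∀ σ, η'.1 σ = η.1 (absGaloisRestrict (w.1.adicCompletion (CyclotomicField m ℚ)) K' σ)) →
        expStarCoordTower W hp' d' η' =
          algebraMap (w.1.adicCompletion (CyclotomicField m ℚ)) K' (expStarCoord W hL
            (d.map gV (ratGalEquiv_intertwines W (Place.Completion (Sum.inr ((primesEquiv (R := 𝓞 ℚ)).symm ⟨p, hp.out⟩) : Place ℚ)) (absGaloisRestrict_eq_conj_towerConjElement_inv (Place.Completion (Sum.inr ((primesEquiv (R := 𝓞 ℚ)).symm ⟨p, hp.out⟩) : Place ℚ)) (w.1.adicCompletion (CyclotomicField m ℚ))) hgVdef)) η))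
    (hlog : ∀ P₀ : (W.baseChange (Place.Completion (Sum.inr ((primesEquiv (R := 𝓞 ℚ)).symm ⟨p, hp.out⟩) : Place ℚ))).toAffine.Point,
      FormalGroupChart.padicLogPointFiniteExt ν (W.baseChange (w.1.adicCompletion (CyclotomicField m ℚ))) p
          (WeierstrassCurve.Affine.Point.map (IsScalarTower.toAlgHom ℚ (Place.Completion (Sum.inr ((primesEquiv (R := 𝓞 ℚ)).symm ⟨p, hp.out⟩) : Place ℚ)) (w.1.adicCompletion (CyclotomicField m ℚ))) P₀) =
        algebraMap (Place.Completion (Sum.inr ((primesEquiv (R := 𝓞 ℚ)).symm ⟨p, hp.out⟩) : Place ℚ)) (w.1.adicCompletion (CyclotomicField m ℚ)) (FormalGroupChart.padicLogPointFiniteExt wv (W.baseChange (Place.Completion (Sum.inr ((primesEquiv (R := 𝓞 ℚ)).symm ⟨p, hp.out⟩) : Place ℚ))) p P₀))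
    (hlog' : ∀ P : (W.baseChange (w.1.adicCompletion (CyclotomicField m ℚ))).toAffine.Point,
      FormalGroupChart.padicLogPointFiniteExt w' (W.baseChange K') p
          (WeierstrassCurve.Affine.Point.map (IsScalarTower.toAlgHom ℚ (w.1.adicCompletion (CyclotomicField m ℚ)) K') P) =
        algebraMap (w.1.adicCompletion (CyclotomicField m ℚ)) K' (FormalGroupChart.padicLogPointFiniteExt ν (W.baseChange (w.1.adicCompletion (CyclotomicField m ℚ))) p P))
    -- Kato's formula over `K'`, any constant
    (c' : K')
    (hrec' : ∀ (η'' : contOneCocycles (restrictedTateRep W K' p).toTopRep) (P' : (W.baseChange K').toAffine.Point),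
      ((tatePairingPoint W K' p e hμ hadd₁ hadd₂ hgal hcompat (oneCocycleClass _ η'') P' : ℤ_[p]) : ℚ_[p]) =
        Algebra.trace ℚ_[p] K'
          (c' * expStarCoord W hp'
              (d'.map gV' (ratGalEquiv_intertwines W (w.1.adicCompletion (CyclotomicField m ℚ)) (absGaloisRestrict_eq_conj_towerConjElement_inv (w.1.adicCompletion (CyclotomicField m ℚ)) K') hgV'def)) η'' *
            FormalGroupChart.padicLogPointFiniteExt w' (W.baseChange K') p P')),
    ∃ c₀ : (Place.Completion (Sum.inr ((primesEquiv (R := 𝓞 ℚ)).symm ⟨p, hp.out⟩) : Place ℚ)), c₀ ≠ 0 ∧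
      (∀ (η₀ : contOneCocycles (restrictedTateRep W (Place.Completion (Sum.inr ((primesEquiv (R := 𝓞 ℚ)).symm ⟨p, hp.out⟩) : Place ℚ)) p).toTopRep) (P₀ : (W.baseChange (Place.Completion (Sum.inr ((primesEquiv (R := 𝓞 ℚ)).symm ⟨p, hp.out⟩) : Place ℚ))).toAffine.Point),
        ((tatePairingPoint W (Place.Completion (Sum.inr ((primesEquiv (R := 𝓞 ℚ)).symm ⟨p, hp.out⟩) : Place ℚ)) p e hμ hadd₁ hadd₂ hgal hcompat (oneCocycleClass _ η₀) P₀ : ℤ_[p]) : ℚ_[p]) =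
          Algebra.trace ℚ_[p] (Place.Completion (Sum.inr ((primesEquiv (R := 𝓞 ℚ)).symm ⟨p, hp.out⟩) : Place ℚ))
            (c₀ * expStarCoord W (valuation_place_lt_one p ((primesEquiv (R := 𝓞 ℚ)).symm ⟨p, hp.out⟩)) d₀ η₀ * FormalGroupChart.padicLogPointFiniteExt wv (W.baseChange (Place.Completion (Sum.inr ((primesEquiv (R := 𝓞 ℚ)).symm ⟨p, hp.out⟩) : Place ℚ))) p P₀)) ∧
      ∀ (η : contOneCocycles ((restrictedTateRep W (Place.Completion (Sum.inr ((primesEquiv (R := 𝓞 ℚ)).symm ⟨p, hp.out⟩) : Place ℚ)) p).restrict (absGaloisRestrict (Place.Completion (Sum.inr ((primesEquiv (R := 𝓞 ℚ)).symm ⟨p, hp.out⟩) : Place ℚ)) (w.1.adicCompletion (CyclotomicField m ℚ)))).toTopRep)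
        (P : (W.baseChange (w.1.adicCompletion (CyclotomicField m ℚ))).toAffine.Point),
        ((tatePairingPointTower W (Place.Completion (Sum.inr ((primesEquiv (R := 𝓞 ℚ)).symm ⟨p, hp.out⟩) : Place ℚ)) e hμ hadd₁ hadd₂ hgal hcompat (oneCocycleClass _ η) P : ℤ_[p]) : ℚ_[p]) =
          Algebra.trace ℚ_[p] (w.1.adicCompletion (CyclotomicField m ℚ))
            (algebraMap (Place.Completion (Sum.inr ((primesEquiv (R := 𝓞 ℚ)).symm ⟨p, hp.out⟩) : Place ℚ)) (w.1.adicCompletion (CyclotomicField m ℚ)) c₀ * expStarCoordTower W hL d η * FormalGroupChart.padicLogPointFiniteExt ν (W.baseChange (w.1.adicCompletion (CyclotomicField m ℚ))) p P) := by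
  intro wv _ _ ν _ _ K' _ _ _ _ _ _ _ _ _ _ hp' _ _ _ w' _ e hμ hadd₁ hadd₂ hgal hcompat gV hgVdef gV' hgV'def hnondeg hinj hde hinj' hde'
    d₀ d d' hcomp hcomp' hlog hlog' c' hrec'
  letI := LocalField.adicCompletionPadicAlgebra w.1 p hw
  letI instEF : Algebra (Place.Completion (K := ℚ) (Sum.inr ((primesEquiv (R := 𝓞 ℚ)).symm ⟨p, hp.out⟩))) (w.1.adicCompletion (CyclotomicField m ℚ)) :=
    inferInstanceAs (Algebra (((primesEquiv (R := 𝓞 ℚ)).symm ⟨p, hp.out⟩).adicCompletion ℚ) (w.1.adicCompletion (CyclotomicField m ℚ)))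
  -- the tower's instance inputs
  haveI : IsGalois (Place.Completion (Sum.inr ((primesEquiv (R := 𝓞 ℚ)).symm ⟨p, hp.out⟩) : Place ℚ)) (w.1.adicCompletion (CyclotomicField m ℚ)) := isGalois_adicCompletion_cyclotomicField m _ w
  haveI : IsCyclotomicExtension {m} (Place.Completion (Sum.inr ((primesEquiv (R := 𝓞 ℚ)).symm ⟨p, hp.out⟩) : Place ℚ)) (w.1.adicCompletion (CyclotomicField m ℚ)) := isCyclotomicExtension_adicCompletion_cyclotomicField m _ w
  haveI : FiniteDimensional (Place.Completion (Sum.inr ((primesEquiv (R := 𝓞 ℚ)).symm ⟨p, hp.out⟩) : Place ℚ)) (w.1.adicCompletion (CyclotomicField m ℚ)) := IsCyclotomicExtension.finiteDimensional {m} (Place.Completion (Sum.inr ((primesEquiv (R := 𝓞 ℚ)).symm ⟨p, hp.out⟩) : Place ℚ)) (w.1.adicCompletion (CyclotomicField m ℚ))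
  haveI : FiniteDimensional ℚ_[p] (Place.Completion (Sum.inr ((primesEquiv (R := 𝓞 ℚ)).symm ⟨p, hp.out⟩) : Place ℚ)) := finiteDimensional_padicAlgebra (valuation_place_lt_one p ((primesEquiv (R := 𝓞 ℚ)).symm ⟨p, hp.out⟩))
  haveI : FiniteDimensional ℚ_[p] (w.1.adicCompletion (CyclotomicField m ℚ)) := finiteDimensional_padicAlgebra hL
  have hcont : Continuous (algebraMap (Place.Completion (Sum.inr ((primesEquiv (R := 𝓞 ℚ)).symm ⟨p, hp.out⟩) : Place ℚ)) (w.1.adicCompletion (CyclotomicField m ℚ))) := w.adicCompletionSemialgHom_continuous ℚ (CyclotomicField m ℚ)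
  haveI : IsScalarTower ℚ_[p] (Place.Completion (Sum.inr ((primesEquiv (R := 𝓞 ℚ)).symm ⟨p, hp.out⟩) : Place ℚ)) (w.1.adicCompletion (CyclotomicField m ℚ)) := isScalarTower_padicAlgebra_of_continuous p hcont (valuation_place_lt_one p ((primesEquiv (R := 𝓞 ℚ)).symm ⟨p, hp.out⟩)) hL
  have hφ : ∃ φ : (W.baseChange (Place.Completion (Sum.inr ((primesEquiv (R := 𝓞 ℚ)).symm ⟨p, hp.out⟩) : Place ℚ))).toAffine.Point →+ ℤ_[p], φ ≠ 0 :=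
    exists_addMonoidHom_baseChange_point_padicInt_ne_zero' W (valuation_place_lt_one p ((primesEquiv (R := 𝓞 ℚ)).symm ⟨p, hp.out⟩)) wv
  exact exists_const_tower_clauses_of_formula_above W (Place.Completion (Sum.inr ((primesEquiv (R := 𝓞 ℚ)).symm ⟨p, hp.out⟩) : Place ℚ)) (valuation_place_lt_one p ((primesEquiv (R := 𝓞 ℚ)).symm ⟨p, hp.out⟩)) wv (w.1.adicCompletion (CyclotomicField m ℚ)) hL ν K' hp' w'
    e hμ hadd₁ hadd₂ hgal hcompat hgVdef hgV'def hnondeg hinj hde hinj' hde' d₀ d d' hcomp hcomp' hlog hlog' c' hrec' hφ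

end Summit.BirchSwinnertonDyer.BirchSwinnertonDyer.Theorems.StarredOptimalManinUnitFiveSevenRecTowerAtCyclotomicFromAbove

end
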